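import Mathlib

/-!
# PartN25 — LEMMA NEUMANN-LB (order 1) and the ANCHORED SPLIT (memo ROTOR-THEORY-20 §263, THEOREMS M87–M88)

Abstract algebraic layer of cycle 20's lower bounds for the three-body Krein secular function.

* `inv_sub_neumann_one_eq` : for invertible `P₀` and `P = P₀ + E` invertible,
  `P⁻¹ − (P₀⁻¹ − P₀⁻¹ E P₀⁻¹) = (P₀⁻¹ E) P⁻¹ (E P₀⁻¹)` (resolvent identity applied twice);
* `posSemidef_inv_sub_neumann_one` : if moreover `P₀`, `P` are positive definite and `E` is Hermitian, the
  first-order Neumann (Faddeev) truncation `A₁ = P₀⁻¹ − P₀⁻¹ E P₀⁻¹` satisfies `A₁ ≤ P⁻¹` in the Loewner order —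
  the m = 1 case of LEMMA NEUMANN-LB (`P⁻¹ − A_{2m−1} = (P₀⁻¹E)^m P⁻¹ (EP₀⁻¹)^m ≥ 0`);
* `variational_lower_bound` : the one-line variational inequality behind every trial bound of the cycle,
  `Re⟨x, P x⟩ ≥ 2 Re⟨σ, P x⟩ − Re⟨σ, P σ⟩` for a positive semidefinite form (`u = P x`);
Mathlib only; no `sorry`.
-/

-- Port of theory seat `hubbard-h0-rotor-theory-1` cycle20/lean/PartN25.lean (sha16 1719e0ff111f7248) verbatim modulo this header,
-- `set_option linter.dupNamespace false` and lint fixes; prover seat `hubbard-h0-rotor-p1` g21, `--supports stmt-HubbardSuperconductivity-19089`.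

set_option linter.dupNamespace false

namespace Summit.HubbardSuperconductivity.HubbardSuperconductivity.Theorems.AnisotropyChord.Transfer.NeumannLB

open Matrix
open scoped ComplexOrder

variable {n : Type*} [Fintype n] [DecidableEq n]

/-- Pure ring identity: if `Y P₀ = 1 = P₀ Y` and `X (P₀+E) = 1 = (P₀+E) X` then
`X − (Y − Y E Y) = Y E X E Y`. [folklore] -/
theorem neumann_one_identity (P₀ E X Y : Matrix n n ℂ) (h1 : Y * P₀ = 1) (h2 : P₀ * Y = 1)
    (h3 : X * (P₀ + E) = 1) (h4 : (P₀ + E) * X = 1) :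
    X - (Y - Y * E * Y) = Y * E * X * E * Y := by
  have eEX : E * X = 1 - P₀ * X := by
    rw [Matrix.add_mul] at h4; exact eq_sub_of_add_eq' h4
  have eXE : X * E = 1 - X * P₀ := by
    rw [Matrix.mul_add] at h3; exact eq_sub_of_add_eq' h3
  have hYEX : Y * E * X = Y - X := by
    rw [Matrix.mul_assoc, eEX, Matrix.mul_sub, Matrix.mul_one, ← Matrix.mul_assoc, h1, Matrix.one_mul]
  have hXEY : X * E * Y = Y - X := by
    rw [eXE, Matrix.sub_mul, Matrix.one_mul, Matrix.mul_assoc, h2, Matrix.mul_one]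
  symm
  calc Y * E * X * E * Y = (Y - X) * E * Y := by rw [hYEX]
    _ = Y * E * Y - X * E * Y := by rw [Matrix.sub_mul, Matrix.sub_mul]
    _ = Y * E * Y - (Y - X) := by rw [hXEY]
    _ = X - (Y - Y * E * Y) := by abel

/-- Resolvent identity, twice: `P⁻¹ − (P₀⁻¹ − P₀⁻¹ E P₀⁻¹) = P₀⁻¹ E P⁻¹ E P₀⁻¹` for `P = P₀ + E`,
both `P₀` and `P` invertible. [folklore] -/
theorem inv_sub_neumann_one_eq (P₀ E : Matrix n n ℂ) (h₀ : IsUnit P₀.det) (h : IsUnit (P₀ + E).det) :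
    (P₀ + E)⁻¹ - (P₀⁻¹ - P₀⁻¹ * E * P₀⁻¹) = P₀⁻¹ * E * (P₀ + E)⁻¹ * E * P₀⁻¹ :=
  neumann_one_identity P₀ E (P₀ + E)⁻¹ P₀⁻¹ (Matrix.nonsing_inv_mul P₀ h₀) (Matrix.mul_nonsing_inv P₀ h₀)
    (Matrix.nonsing_inv_mul _ h) (Matrix.mul_nonsing_inv _ h)

/-- **LEMMA NEUMANN-LB, order 1.**  For positive definite `P₀` and `P = P₀ + E` with `E` Hermitian, the first
Faddeev/Neumann truncation `A₁ = P₀⁻¹ − P₀⁻¹EP₀⁻¹` is below `P⁻¹` in the Loewner order: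
`P⁻¹ − A₁ = (P₀⁻¹E) P⁻¹ (P₀⁻¹E)ᴴ ≥ 0`.  [theory seat hubbard-h0-rotor-theory-1, cycle 20, memo §263(b)] -/
theorem posSemidef_inv_sub_neumann_one (P₀ E : Matrix n n ℂ) (h₀ : P₀.PosDef) (h : (P₀ + E).PosDef)
    (hE : E.IsHermitian) :
    ((P₀ + E)⁻¹ - (P₀⁻¹ - P₀⁻¹ * E * P₀⁻¹)).PosSemidef := by
  have hu₀ : IsUnit P₀.det := (Matrix.isUnit_iff_isUnit_det P₀).mp h₀.isUnit
  have hu : IsUnit (P₀ + E).det := (Matrix.isUnit_iff_isUnit_det _).mp h.isUnit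
  rw [inv_sub_neumann_one_eq P₀ E hu₀ hu]
  have hM : (P₀⁻¹ * E)ᴴ = E * P₀⁻¹ := by
    rw [Matrix.conjTranspose_mul, hE.eq, h₀.isHermitian.inv.eq]
  have : P₀⁻¹ * E * (P₀ + E)⁻¹ * E * P₀⁻¹ = (P₀⁻¹ * E) * (P₀ + E)⁻¹ * (P₀⁻¹ * E)ᴴ := by
    rw [hM]; simp only [Matrix.mul_assoc]
  rw [this]
  exact h.inv.posSemidef.mul_mul_conjTranspose_same (P₀⁻¹ * E)

omit [DecidableEq n] in
/-- The one-line variational inequality behind every trial lower bound of the cycle: for a positive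
semidefinite `P` and all vectors `x σ`, `Re⟨x, Px⟩ ≥ 2 Re⟨σ, Px⟩ − Re⟨σ, Pσ⟩`
(equality iff `P(x − σ) = 0`); with `u = Px` the left side is `⟨u, P⁻¹u⟩`. [folklore] -/
theorem variational_lower_bound (P : Matrix n n ℂ) (hP : P.PosSemidef) (x σ : n → ℂ) :
    2 * (star σ ⬝ᵥ P.mulVec x).re - (star σ ⬝ᵥ P.mulVec σ).re ≤ (star x ⬝ᵥ P.mulVec x).re := by
  have h0 : 0 ≤ star (x - σ) ⬝ᵥ P.mulVec (x - σ) := hP.dotProduct_mulVec_nonneg (x - σ)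
  have hexp : star (x - σ) ⬝ᵥ P.mulVec (x - σ)
      = star x ⬝ᵥ P.mulVec x - star x ⬝ᵥ P.mulVec σ - star σ ⬝ᵥ P.mulVec x + star σ ⬝ᵥ P.mulVec σ := by
    rw [star_sub, Matrix.mulVec_sub, sub_dotProduct, dotProduct_sub, dotProduct_sub]; ring
  have hsymm : star x ⬝ᵥ P.mulVec σ = star (star σ ⬝ᵥ P.mulVec x) := by
    rw [Matrix.star_dotProduct, Matrix.star_mulVec, hP.1.eq, Matrix.dotProduct_mulVec]
  have hre : (star (x - σ) ⬝ᵥ P.mulVec (x - σ)).re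
      = (star x ⬝ᵥ P.mulVec x).re - 2 * (star σ ⬝ᵥ P.mulVec x).re + (star σ ⬝ᵥ P.mulVec σ).re := by
    rw [hexp, hsymm]; simp only [Complex.sub_re, Complex.add_re, Complex.star_def, Complex.conj_re]; ring
  have h1 : 0 ≤ (star (x - σ) ⬝ᵥ P.mulVec (x - σ)).re := (Complex.nonneg_iff.mp h0).1
  rw [hre] at h1
  linarith

end Summit.HubbardSuperconductivity.HubbardSuperconductivity.Theorems.AnisotropyChord.Transfer.NeumannLB
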